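import Summits.AtomisticToContinuum.HydrodynamicLimit.Theorems.BoxDissipativeWeakStrongLocalGibbsFineScaleUniformOnePt

/-!
# `LocalGibbsFineScale` (route `BoxDissipativeWeakStrong`), file 4: the variance of a kernel average,
uniformly in the centre

Support lemmas for item stmt-AtomisticToContinuum-9905. For a family of averaging kernels
`g_N(x, ·) ≥ 0` (measurable, bounded by `C_N`, unit mass, supported in the sup-ball of radius
`r_N → 0` around `x`) at a **kinetic window**, `C_N / (N+1) → 0` (for the box kernel `C_N = ℓ_N⁻³`,
this is `(N+1) ℓ_N³ → ∞`), the empirical average `A_N(x) = (N+1)⁻¹ ∑ᵢ g_N(x, qᵢ)` of the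
`N + 1`-particle canonical hard-sphere gas at small reduced density concentrates, uniformly in `x`:

* `twoPt_kernel_uniform`: `∀ δ > 0, ∀ᶠ N, ∀ x, |E_{N+1}[g_N(x,q₀) g_N(x,q₁)] - ρ₀(x)²| ≤ δ` — the
  two-point decorated expansion of the tree (`integral_two_point_eq`): the block of `q₀` avoids
  `q₁` (termwise uniform limits from file 3, geometric domination by the `L¹` tree bound) or
  contains it (same-block remainder, `O(C_N λ/(N+1))` by the `L¹ × sup` bound of file 1);
* the variance bound itself (`variance_kernel_uniform`, via the variance identity of
  `HardSphereEulerLLN`) is in the next file.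

References: Spohn 1991, Part I §2.3 (2.45)–(2.46); Pulvirenti–Tsagkarogiannis 2012 §3–5.
-/

noncomputable section

namespace Summit.AtomisticToContinuum.HydrodynamicLimit.Theorems
namespace LGFS
open MeasureTheory Finset Filter Topology Metric
open Literature.Probability.LatticeModels Literature.MathematicalPhysics.StatisticalMechanics
  Literature.MathematicalPhysics.KineticTheory
open scoped ENNReal

variable {P : DensityProfile} {σ : ℝ}

/-! ### Bounds on `ρ₀` and on the one-point expectation of a square -/

/-- `|ρ₀(x)| ≤ 2eM/(1-θ)` (geometric majorant of the defining series). -/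
theorem abs_rhoLim_le (hs : SmallDensity P σ) (x : T3) :
    |rhoLim P σ x| ≤ 2 * Real.exp 1 * P.M / (1 - geomRatio P σ) := by
  have hθ0 := hs.geomRatio_nonneg
  have hθ1 := hs.geomRatio_lt_one
  have hgeo : HasSum (fun j : ℕ => 2 * Real.exp 1 * P.M * geomRatio P σ ^ j)
      (2 * Real.exp 1 * P.M / (1 - geomRatio P σ)) := by
    have h := (hasSum_geometric_of_lt_one hθ0 hθ1).mul_left (2 * Real.exp 1 * P.M)
    rwa [← div_eq_mul_inv] at h
  rw [rhoLim]
  refine (Real.norm_eq_abs _).symm.trans_le (tsum_of_norm_bounded hgeo fun j => ?_)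
  rw [Real.norm_eq_abs]
  exact hs.abs_rhoLim_term_le j x

/-- Monotonicity of the decorated partition function in the (nonnegative difference of the)
observable: `M^{χ₁}(m) ≤ M^{χ₂}(m)` for `χ₁ ≤ χ₂` bounded measurable. -/
theorem Md_mono {ε : ℝ} {n : ℕ} [NeZero n] {χ₁ χ₂ : T3 → ℝ} (h₁ : Measurable χ₁) (h₂ : Measurable χ₂)
    {C₁ C₂ : ℝ} (hC₁ : ∀ y, |χ₁ y| ≤ C₁) (hC₂ : ∀ y, |χ₂ y| ≤ C₂) (hle : ∀ y, χ₁ y ≤ χ₂ y) (m : ℕ) :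
    Md P ε n χ₁ m ≤ Md P ε n χ₂ m := by
  have hO := measurableSet_ov ε
  rw [Md, Md, decPF, decPF]
  refine integral_mono ?_ ?_ fun x => mul_le_mul_of_nonneg_right (hle _) (efR_nonneg x _)
  · exact integrable_pi_of_bounded P.μ ((h₁.comp (measurable_pi_apply 0)).mul (measurable_efR hO _))
      (C := C₁ * 1) fun x => by
        rw [abs_mul]
        exact mul_le_mul (hC₁ _) (abs_efR_le_one x _) (abs_nonneg _) ((abs_nonneg _).trans (hC₁ (x 0)))
  · exact integrable_pi_of_bounded P.μ ((h₂.comp (measurable_pi_apply 0)).mul (measurable_efR hO _))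
      (C := C₂ * 1) fun x => by
        rw [abs_mul]
        exact mul_le_mul (hC₂ _) (abs_efR_le_one x _) (abs_nonneg _) ((abs_nonneg _).trans (hC₂ (x 0)))

/-- **The one-point expectation of the square of a kernel**: `0 ≤ E[g(x₀)²] ≤ 2 C ∫ g dμ` for
`0 ≤ g ≤ C` (since `g² ≤ C g` and `E[g] ≤ 2 ∫ g dμ`). -/
theorem onePt_sq_le (hs : SmallDensity P σ) {g : T3 → ℝ} (hg : Measurable g) {C : ℝ}
    (hg0 : ∀ y, 0 ≤ g y) (hgC : ∀ y, g y ≤ C) {N s : ℕ} (hsN : s ≤ N) :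
    onePt P σ (fun y => g y ^ 2) N s ≤ 2 * C * ∫ y, g y ∂P.μ := by
  have hC0 : 0 ≤ C := (hg0 0).trans (hgC 0)
  have hgC' : ∀ y, |g y| ≤ C := abs_le_of_nonneg_of_le hg0 hgC
  have hXi := XiN_pos hs.σ_pos.le hs.σ_lt_half hs.ovDensity_lt_one (N := N) (m := N + 1 - s)
    (Nat.sub_le _ _)
  have h1 : onePt P σ (fun y => g y ^ 2) N s ≤ onePt P σ (fun y => C * g y) N s := by
    rw [onePt, onePt]
    refine div_le_div_of_nonneg_right ?_ hXi.le
    refine Md_mono (χ₁ := fun y => g y ^ 2) (χ₂ := fun y => C * g y) (hg.pow_const 2)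
      (measurable_const.mul hg) (C₁ := C ^ 2) (C₂ := C * C)
      (fun y => ?_) (fun y => ?_) (kernel_sq_le hg0 hgC) _
    · rw [abs_pow]; exact pow_le_pow_left₀ (abs_nonneg _) (hgC' y) 2
    · rw [abs_mul, abs_of_nonneg hC0]; exact mul_le_mul_of_nonneg_left (hgC' y) hC0
  have h2 : onePt P σ (fun y => C * g y) N s = C * onePt P σ g N s := by
    rw [onePt, onePt, Md_const_mul, mul_div_assoc]
  rw [h2] at h1
  calc onePt P σ (fun y => g y ^ 2) N s ≤ C * onePt P σ g N s := h1
    _ ≤ C * (2 * ∫ y, g y ∂P.μ) :=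
        mul_le_mul_of_nonneg_left (onePt_le_two_mul hs hg hgC' hg0 hsN) hC0
    _ = 2 * C * ∫ y, g y ∂P.μ := by ring

/-! ### The two-point expansion in size form -/

/-- **Two-point decorated expansion, size form, divided by the partition function**: for `1 ≤ N`
and `χ` bounded measurable,
`E_{N+1}[χ(q₀)χ(q₁)] = ∑_{j<N} C(N-1,j) W^χ_N(j+1) · E_{N-j}[χ] · r_N(N+1, j+1) + same-block / Ξ`. -/
theorem twoPt_eq_sum_add (hs : SmallDensity P σ) {χ : T3 → ℝ} (hχ : Measurable χ) {C : ℝ}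
    (hχC : ∀ y, |χ y| ≤ C) {N : ℕ} (h2 : 2 ≤ N + 1) :
    twoPt P σ χ N =
      ∑ j ∈ range N, coefN P σ N χ (N - 1) j * onePt P σ χ N (j + 1) * rN P σ N (N + 1) (j + 1) +
        sameBlockRem P (hsDiameter σ N) (N + 1) h2 χ χ / XiN P σ N (N + 1) := by
  have hlam1 := hs.ovDensity_lt_one
  have hXi := XiN_pos hs.σ_pos.le hs.σ_lt_half hlam1 (N := N) (m := N + 1) le_rfl
  rw [twoPt, dif_pos h2]
  simp only [XiN]
  rw [integral_two_point_eq (P := P) (n := N + 1) h2 hχ hχ hχC hχC, add_div, sum_div]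
  congr 1
  simp only [Nat.add_sub_cancel]
  refine sum_congr rfl fun j hj => ?_
  have hj' := mem_range.mp hj
  have hXij := XiN_pos hs.σ_pos.le hs.σ_lt_half hlam1 (N := N) (m := N - j) (by omega)
  simp only [coefN, onePt, rN, XiN]
  rw [show N + 1 - 2 = N - 1 by omega, show N + 1 - (j + 1) = N - j by omega]
  rw [XiN] at hXij hXi
  field_simp

/-- **Termwise bound for the two-point expansion**: for `0 ≤ χ` bounded measurable with
`∫ χ dμ ≤ I` and `j < N`, `|C(N-1,j) W^χ(j+1) E_{N-j}[χ] r_N(N+1,j+1)| ≤ 4 e I² θʲ`. -/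
theorem abs_twoPt_term_le (hs : SmallDensity P σ) {χ : T3 → ℝ} (hχ : Measurable χ) {C : ℝ}
    (hχ0 : ∀ y, 0 ≤ χ y) (hχC : ∀ y, χ y ≤ C) {I : ℝ} (hI : ∫ y, χ y ∂P.μ ≤ I) {N j : ℕ} (hj : j < N) :
    |coefN P σ N χ (N - 1) j * onePt P σ χ N (j + 1) * rN P σ N (N + 1) (j + 1)| ≤
      4 * Real.exp 1 * I ^ 2 * geomRatio P σ ^ j := by
  have hlam1 := hs.ovDensity_lt_one
  have hl0 := hs.ovDensity_nonneg
  have hχC' : ∀ y, |χ y| ≤ C := abs_le_of_nonneg_of_le hχ0 hχC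
  have hI' : ∫ y, |χ y| ∂P.μ ≤ I := by simp_rw [abs_of_nonneg (hχ0 _)]; exact hI
  have hI0 : 0 ≤ I := (integral_nonneg hχ0).trans hI
  have hco := MesoLLN.abs_coefN_le_integral (P := P) hs.σ_pos.le hs.σ_lt_half hχ hχC'
    (N := N) (m := N - 1) (j := j) (by omega) (by omega)
  have ho0 : 0 ≤ onePt P σ χ N (j + 1) := MesoLLN.onePt_nonneg hs hχ0 N (j + 1)
  have ho2 : onePt P σ χ N (j + 1) ≤ 2 * I :=
    (onePt_le_two_mul hs hχ hχC' hχ0 (by omega)).trans (by linarith)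
  have hr0 : 0 ≤ rN P σ N (N + 1) (j + 1) :=
    zero_le_one.trans (one_le_rN hs.σ_pos.le hs.σ_lt_half hlam1 le_rfl (by omega))
  have hr2 := hs.rN_le_two_pow (N := N) (m := N + 1) (j := j + 1) le_rfl (by omega)
  rw [abs_mul, abs_mul, abs_of_nonneg ho0, abs_of_nonneg hr0]
  calc |coefN P σ N χ (N - 1) j| * onePt P σ χ N (j + 1) * rN P σ N (N + 1) (j + 1)
      ≤ (I * (Real.exp 1 * (Real.exp 1 * ovDensity P σ) ^ j)) * (2 * I) * 2 ^ (j + 1) :=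
        mul_le_mul (mul_le_mul (hco.trans (mul_le_mul_of_nonneg_right hI' (by positivity))) ho2 ho0
          (by positivity)) hr2 hr0 (by positivity)
    _ = 4 * Real.exp 1 * I ^ 2 * geomRatio P σ ^ j := by rw [geomRatio]; ring

/-- `|γ_{j+1} β(x)^{j+1}| ≤ M e (eλ)ʲ`. -/
theorem abs_clusterCoeff_mul_pow_le (hs : SmallDensity P σ) (j : ℕ) (x : T3) :
    |clusterCoeff σ j * P.β x ^ (j + 1)| ≤ P.M * (Real.exp 1 * (Real.exp 1 * ovDensity P σ) ^ j) := by
  have hγ := abs_clusterCoeff_le hs.σ_pos hs.σ_lt_half j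
  have hβ0 := (P.pos x).le
  have hM := P.M_pos
  have hv := v₁_pos
  have hσ3 : 0 ≤ σ ^ 3 := pow_nonneg hs.σ_pos.le 3
  rw [abs_mul, abs_of_nonneg (pow_nonneg hβ0 _)]
  calc |clusterCoeff σ j| * P.β x ^ (j + 1)
      ≤ (Real.exp 1 * (Real.exp 1 * (v₁ * σ ^ 3)) ^ j) * P.M ^ (j + 1) := by
        gcongr
        · exact P.le_M x
    _ = P.M * (Real.exp 1 * (Real.exp 1 * ovDensity P σ) ^ j) := by
        rw [ovDensity, pow_succ, mul_pow, mul_pow]; ring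

/-! ### The terms of the two-point expansion converge uniformly in the centre -/

/-- **Termwise uniform limit for the two-point expansion**: for every `j`,
`∀ η > 0, ∀ᶠ N, ∀ x, |C(N-1,j) W^{g_N(x,·)}(j+1) E_{N-j}[g_N(x,·)] r_N(N+1,j+1) - γ_{j+1} R^{j+1} β(x)^{j+1} ρ₀(x)| ≤ η`. -/
theorem twoPt_term_kernel_uniform (hs : SmallDensity P σ) {g : ℕ → T3 → T3 → ℝ} {Cg r : ℕ → ℝ}
    (hgm : ∀ N x, Measurable (g N x)) (hg0 : ∀ N x y, 0 ≤ g N x y) (hgC : ∀ N x y, g N x y ≤ Cg N)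
    (hg1 : ∀ N x, ∫ y, g N x y = 1) (hsupp : ∀ N x y, g N x y ≠ 0 → dist y x < r N)
    (hr : Tendsto r atTop (𝓝 0)) (j : ℕ) {η : ℝ} (hη : 0 < η) :
    ∀ᶠ N in atTop, ∀ x, |coefN P σ N (g N x) (N - 1) j * onePt P σ (g N x) N (j + 1) * rN P σ N (N + 1) (j + 1) -
      clusterCoeff σ j * ratioLimit P σ ^ (j + 1) * P.β x ^ (j + 1) * rhoLim P σ x| ≤ η := by
  have hl0 := hs.ovDensity_nonneg
  have hM := P.M_pos
  have hθ1 := hs.geomRatio_lt_one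
  set B := P.M * (Real.exp 1 * (Real.exp 1 * ovDensity P σ) ^ j) with hB
  have hB0 : 0 ≤ B := by positivity
  set R := ratioLimit P σ with hR
  have hR0 : 0 ≤ R ^ (j + 1) := pow_nonneg hs.ratioLimit_pos.le _
  have hR2 : R ^ (j + 1) ≤ 2 ^ (j + 1) := pow_le_pow_left₀ hs.ratioLimit_pos.le hs.ratioLimit_mem.2 _
  set ρm := 2 * Real.exp 1 * P.M / (1 - geomRatio P σ) with hρm
  have hρm0 : 0 ≤ ρm := by rw [hρm]; exact div_nonneg (by positivity) (by linarith)
  -- small parameters: `|c - γβ| o r`, `|γβ| |o - ρ₀| r`, `|γβ ρ₀| |r - R|`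
  obtain ⟨η₁, hη₁, hη₁le⟩ := exists_pos_mul_le (ε := η / 3) (K := 2 * P.M * 2 ^ (j + 1)) (by positivity)
    (by positivity)
  obtain ⟨η₂, hη₂, hη₂le⟩ := exists_pos_mul_le (ε := η / 3) (K := B * 2 ^ (j + 1)) (by positivity)
    (by positivity)
  obtain ⟨η₃, hη₃, hη₃le⟩ := exists_pos_mul_le (ε := η / 3) (K := B * ρm) (by positivity) (by positivity)
  have hE1 := coefN_kernel_uniform hs hgm hg0 hgC hg1 hsupp hr 1 j hη₁
  have hE2 := onePt_kernel_uniform hs hgm hg0 hgC hg1 hsupp hr (j + 1) hη₂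
  have hE3 : ∀ᶠ N : ℕ in atTop, |rN P σ N (N + 1) (j + 1) - R ^ (j + 1)| ≤ η₃ := by
    have h := hs.tendsto_rN 0 (j + 1)
    simp only [Nat.sub_zero] at h
    rw [← hR] at h
    have h2 : Tendsto (fun N => |rN P σ N (N + 1) (j + 1) - R ^ (j + 1)|) atTop (𝓝 0) := by
      have := (h.sub_const (R ^ (j + 1))).abs
      rw [sub_self, abs_zero] at this
      exact this
    exact (h2.eventually (ge_mem_nhds hη₃)).mono fun N hN => hN
  have hE4 : ∀ᶠ N : ℕ in atTop, j + 1 ≤ N := eventually_ge_atTop _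
  filter_upwards [hE1, hE2, hE3, hE4] with N hN1 hN2 hN3 hN4 x
  have hlam1 := hs.ovDensity_lt_one
  have hgxm := hgm N x
  have hgxC' : ∀ y, |g N x y| ≤ Cg N := abs_le_of_nonneg_of_le (hg0 N x) (hgC N x)
  -- the factors and their bounds
  set c := coefN P σ N (g N x) (N - 1) j with hc
  set o := onePt P σ (g N x) N (j + 1) with ho
  set rr := rN P σ N (N + 1) (j + 1) with hrr
  set γβ := clusterCoeff σ j * P.β x ^ (j + 1) with hγβ
  have hco : |c| ≤ B := by
    refine (MesoLLN.abs_coefN_le_integral (P := P) hs.σ_pos.le hs.σ_lt_half hgxm hgxC'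
      (N := N) (m := N - 1) (j := j) (by omega) (by omega)).trans ?_
    exact mul_le_mul_of_nonneg_right
      (integral_abs_kernel_μ_le P hgxm (hg0 N x) (hgC N x) (hg1 N x)) (by positivity)
  have ho0 : 0 ≤ o := MesoLLN.onePt_nonneg hs (hg0 N x) N (j + 1)
  have ho2 : o ≤ 2 * P.M :=
    (onePt_le_two_mul hs hgxm hgxC' (hg0 N x) hN4).trans
      (by linarith [integral_kernel_μ_le P hgxm (hg0 N x) (hgC N x) (hg1 N x)])
  have hr0 : 0 ≤ rr := zero_le_one.trans (one_le_rN hs.σ_pos.le hs.σ_lt_half hlam1 le_rfl (by omega))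
  have hr2 : rr ≤ 2 ^ (j + 1) := hs.rN_le_two_pow (N := N) (m := N + 1) (j := j + 1) le_rfl (by omega)
  have hγβle : |γβ| ≤ B := abs_clusterCoeff_mul_pow_le hs j x
  have hρle : |rhoLim P σ x| ≤ ρm := abs_rhoLim_le hs x
  -- telescoping
  have hsplit : c * o * rr - clusterCoeff σ j * R ^ (j + 1) * P.β x ^ (j + 1) * rhoLim P σ x =
      (c - γβ) * o * rr + γβ * (o - rhoLim P σ x) * rr + γβ * rhoLim P σ x * (rr - R ^ (j + 1)) := by
    rw [hγβ]; ring
  rw [hsplit]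
  have hT1 : |(c - γβ) * o * rr| ≤ η / 3 := by
    rw [abs_mul, abs_mul, abs_of_nonneg ho0, abs_of_nonneg hr0]
    calc |c - γβ| * o * rr ≤ η₁ * (2 * P.M) * 2 ^ (j + 1) :=
          mul_le_mul (mul_le_mul (hN1 x) ho2 ho0 hη₁.le) hr2 hr0 (by positivity)
      _ = 2 * P.M * 2 ^ (j + 1) * η₁ := by ring
      _ ≤ η / 3 := hη₁le
  have hT2 : |γβ * (o - rhoLim P σ x) * rr| ≤ η / 3 := by
    rw [abs_mul, abs_mul, abs_of_nonneg hr0]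
    calc |γβ| * |o - rhoLim P σ x| * rr ≤ B * η₂ * 2 ^ (j + 1) :=
          mul_le_mul (mul_le_mul hγβle (hN2 x) (abs_nonneg _) hB0) hr2 hr0 (by positivity)
      _ = B * 2 ^ (j + 1) * η₂ := by ring
      _ ≤ η / 3 := hη₂le
  have hT3 : |γβ * rhoLim P σ x * (rr - R ^ (j + 1))| ≤ η / 3 := by
    rw [abs_mul, abs_mul]
    calc |γβ| * |rhoLim P σ x| * |rr - R ^ (j + 1)| ≤ B * ρm * η₃ :=
          mul_le_mul (mul_le_mul hγβle hρle (abs_nonneg _) hB0) hN3 (abs_nonneg _) (by positivity)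
      _ ≤ η / 3 := hη₃le
  calc |(c - γβ) * o * rr + γβ * (o - rhoLim P σ x) * rr + γβ * rhoLim P σ x * (rr - R ^ (j + 1))|
      ≤ |(c - γβ) * o * rr| + |γβ * (o - rhoLim P σ x) * rr| + |γβ * rhoLim P σ x * (rr - R ^ (j + 1))| :=
        abs_add_three _ _ _
    _ ≤ η / 3 + η / 3 + η / 3 := add_le_add_three hT1 hT2 hT3
    _ = η := by ring

/-! ### The two-point expectation of a shrinking kernel at a kinetic window -/

/-- **Uniform two-point limit**: for a kernel family as above at a kinetic window
(`C_N/(N+1) → 0`), `∀ δ > 0, ∀ᶠ N, ∀ x, |E_{N+1}[g_N(x,q₀) g_N(x,q₁)] - ρ₀(x)²| ≤ δ`. -/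
theorem twoPt_kernel_uniform (hs : SmallDensity P σ) {g : ℕ → T3 → T3 → ℝ} {Cg r : ℕ → ℝ}
    (hgm : ∀ N x, Measurable (g N x)) (hg0 : ∀ N x y, 0 ≤ g N x y) (hgC : ∀ N x y, g N x y ≤ Cg N)
    (hg1 : ∀ N x, ∫ y, g N x y = 1) (hsupp : ∀ N x y, g N x y ≠ 0 → dist y x < r N)
    (hr : Tendsto r atTop (𝓝 0)) (hwin : Tendsto (fun N : ℕ => Cg N / ((N : ℝ) + 1)) atTop (𝓝 0))
    {δ : ℝ} (hδ : 0 < δ) :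
    ∀ᶠ N in atTop, ∀ x, |twoPt P σ (g N x) N - rhoLim P σ x ^ 2| ≤ δ := by
  have hθ0 := hs.geomRatio_nonneg
  have hθ1 := hs.geomRatio_lt_one
  have hl0 := hs.ovDensity_nonneg
  have hM := P.M_pos
  set θ := geomRatio P σ with hθ
  set ρm := 2 * Real.exp 1 * P.M / (1 - geomRatio P σ) with hρm
  have hρm0 : 0 ≤ ρm := by rw [hρm]; exact div_nonneg (by positivity) (by linarith)
  -- a common geometric majorant `A θʲ` for the terms and for the limit terms
  set A := 4 * Real.exp 1 * P.M ^ 2 + 2 * Real.exp 1 * P.M * ρm with hA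
  have hA0 : 0 ≤ A := by positivity
  have htail : Tendsto (fun J : ℕ => A * θ ^ J / (1 - θ)) atTop (𝓝 0) := by
    have := ((tendsto_pow_atTop_nhds_zero_of_lt_one hθ0 hθ1).const_mul A).div_const (1 - θ)
    rw [mul_zero, zero_div] at this
    exact this
  obtain ⟨J, hJ⟩ := (htail.eventually (ge_mem_nhds (by positivity : (0 : ℝ) < δ / 5))).exists
  have hgeo : HasSum (fun i : ℕ => A * θ ^ J * θ ^ i) (A * θ ^ J / (1 - θ)) := by
    have h := (hasSum_geometric_of_lt_one hθ0 hθ1).mul_left (A * θ ^ J)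
    rwa [← div_eq_mul_inv] at h
  -- the head
  have hhead : ∀ᶠ N in atTop, ∀ j ∈ range J, ∀ x,
      |coefN P σ N (g N x) (N - 1) j * onePt P σ (g N x) N (j + 1) * rN P σ N (N + 1) (j + 1) -
        clusterCoeff σ j * ratioLimit P σ ^ (j + 1) * P.β x ^ (j + 1) * rhoLim P σ x| ≤
        δ / (5 * ((J : ℝ) + 1)) := by
    refine (Finset.eventually_all (range J)).2 fun j _ => ?_
    exact twoPt_term_kernel_uniform hs hgm hg0 hgC hg1 hsupp hr j (by positivity)
  -- the same-block remainder: `4 e² M C_N S p_{ε_N} → 0`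
  set S := geomRatio P σ / (1 - geomRatio P σ) ^ 2 + (1 - geomRatio P σ)⁻¹ with hS
  have hS0 : 0 ≤ S := hs.hasSum_succ_mul_geomRatio_pow.nonneg fun j => by positivity
  have hrem : ∀ᶠ N : ℕ in atTop,
      4 * Real.exp 1 ^ 2 * (P.M * Cg N) * S * pOv P (hsDiameter σ N) ≤ δ / 5 := by
    have h1 : Tendsto (fun N : ℕ => 4 * Real.exp 1 ^ 2 * P.M * S * ovDensity P σ * (Cg N / ((N : ℝ) + 1)))
        atTop (𝓝 0) := by
      have := hwin.const_mul (4 * Real.exp 1 ^ 2 * P.M * S * ovDensity P σ)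
      rw [mul_zero] at this
      exact this
    refine (h1.eventually (ge_mem_nhds (by positivity : (0 : ℝ) < δ / 5))).mono fun N hN => ?_
    refine le_trans (le_of_eq ?_) hN
    rw [pOv_hsDiameter]; push_cast; ring
  have hE : ∀ᶠ N : ℕ in atTop, J + 1 ≤ N := eventually_ge_atTop _
  filter_upwards [hhead, hrem, hE] with N hN hNrem hNJ x
  have hlam1 := hs.ovDensity_lt_one
  have hgxm := hgm N x
  have hgxC' : ∀ y, |g N x y| ≤ Cg N := abs_le_of_nonneg_of_le (hg0 N x) (hgC N x)
  have hI : ∫ y, g N x y ∂P.μ ≤ P.M := integral_kernel_μ_le P hgxm (hg0 N x) (hgC N x) (hg1 N x)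
  have hIa : ∫ y, |g N x y| ∂P.μ ≤ P.M := integral_abs_kernel_μ_le P hgxm (hg0 N x) (hgC N x) (hg1 N x)
  have h2 : 2 ≤ N + 1 := by omega
  -- names
  set G : ℕ → ℝ := fun j =>
    coefN P σ N (g N x) (N - 1) j * onePt P σ (g N x) N (j + 1) * rN P σ N (N + 1) (j + 1) with hG
  set T : ℕ → ℝ := fun j =>
    clusterCoeff σ j * ratioLimit P σ ^ (j + 1) * P.β x ^ (j + 1) * rhoLim P σ x with hT
  have hGle : ∀ j, j < N → |G j| ≤ A * θ ^ j := fun j hj => by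
    refine (abs_twoPt_term_le hs hgxm (hg0 N x) (hgC N x) hI hj).trans ?_
    rw [hA, add_mul]
    have : 0 ≤ 2 * Real.exp 1 * P.M * ρm * θ ^ j := by positivity
    linarith
  have hTle : ∀ j, |T j| ≤ A * θ ^ j := fun j => by
    have h1 := hs.abs_rhoLim_term_le j x
    have h2 := abs_rhoLim_le hs x
    rw [hT]; dsimp only
    rw [abs_mul]
    calc |clusterCoeff σ j * ratioLimit P σ ^ (j + 1) * P.β x ^ (j + 1)| * |rhoLim P σ x|
        ≤ (2 * Real.exp 1 * P.M * θ ^ j) * ρm := mul_le_mul h1 h2 (abs_nonneg _) (by positivity)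
      _ ≤ A * θ ^ j := by
          rw [hA, add_mul]
          have : 0 ≤ 4 * Real.exp 1 * P.M ^ 2 * θ ^ j := by positivity
          nlinarith
  -- the expansions
  have hexp : twoPt P σ (g N x) N = ∑ j ∈ range J, G j + ∑ j ∈ Ico J N, G j +
      sameBlockRem P (hsDiameter σ N) (N + 1) h2 (g N x) (g N x) / XiN P σ N (N + 1) := by
    rw [twoPt_eq_sum_add hs hgxm hgxC' h2, Finset.sum_range_add_sum_Ico _ (show J ≤ N by omega)]
  have hsumT : Summable T := by
    refine Summable.of_norm_bounded ((summable_geometric_of_lt_one hθ0 hθ1).mul_left A) fun j => ?_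
    rw [Real.norm_eq_abs]; exact hTle j
  have hrho : rhoLim P σ x ^ 2 = ∑ j ∈ range J, T j + ∑' j, T (j + J) := by
    rw [hsumT.sum_add_tsum_nat_add J]
    simp only [hT]
    rw [tsum_mul_right, ← rhoLim, sq]
  rw [hexp, hrho]
  -- the pieces
  have h1 : |∑ j ∈ range J, G j - ∑ j ∈ range J, T j| ≤ δ / 5 := by
    rw [← sum_sub_distrib]
    calc |∑ j ∈ range J, (G j - T j)| ≤ ∑ j ∈ range J, |G j - T j| := abs_sum_le_sum_abs _ _
      _ ≤ ∑ _j ∈ range J, δ / (5 * ((J : ℝ) + 1)) := sum_le_sum fun j hj => hN j hj x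
      _ = J * (δ / (5 * ((J : ℝ) + 1))) := by rw [sum_const, card_range, nsmul_eq_mul]
      _ ≤ δ / 5 := by
          rw [mul_div_assoc', div_le_div_iff₀ (by positivity) (by positivity)]
          nlinarith
  have h2' : |∑ j ∈ Ico J N, G j| ≤ δ / 5 := by
    calc |∑ j ∈ Ico J N, G j| ≤ ∑ j ∈ Ico J N, |G j| := abs_sum_le_sum_abs _ _
      _ ≤ ∑ j ∈ Ico J N, A * θ ^ j := sum_le_sum fun j hj => hGle j (mem_Ico.1 hj).2
      _ = ∑ i ∈ range (N - J), A * θ ^ J * θ ^ i := by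
          rw [sum_Ico_eq_sum_range]
          refine sum_congr rfl fun i _ => ?_
          rw [pow_add]; ring
      _ ≤ A * θ ^ J / (1 - θ) := sum_le_hasSum _ (fun i _ => by positivity) hgeo
      _ ≤ δ / 5 := hJ
  have h3 : |∑' j, T (j + J)| ≤ δ / 5 := by
    refine le_trans ?_ hJ
    refine (Real.norm_eq_abs _).symm.trans_le (tsum_of_norm_bounded hgeo fun i => ?_)
    rw [Real.norm_eq_abs]
    calc |T (i + J)| ≤ A * θ ^ (i + J) := hTle (i + J)
      _ = A * θ ^ J * θ ^ i := by rw [pow_add]; ring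
  have h4 : |sameBlockRem P (hsDiameter σ N) (N + 1) h2 (g N x) (g N x) / XiN P σ N (N + 1)| ≤ δ / 5 := by
    refine (abs_sameBlockRem_div_le_L1 hs hgxm hgxm hgxC' hgxC' N h2).trans (le_trans ?_ hNrem)
    have hp0 : 0 ≤ pOv P (hsDiameter σ N) := pOv_nonneg P (hsDiameter_nonneg' hs.σ_pos.le N)
    have hCg : 0 ≤ Cg N := (hg0 N x x).trans (hgC N x x)
    have : (∫ y, |g N x y| ∂P.μ) * Cg N ≤ P.M * Cg N := mul_le_mul_of_nonneg_right hIa hCg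
    gcongr
  have hsplit : ∑ j ∈ range J, G j + ∑ j ∈ Ico J N, G j +
      sameBlockRem P (hsDiameter σ N) (N + 1) h2 (g N x) (g N x) / XiN P σ N (N + 1) -
      (∑ j ∈ range J, T j + ∑' j, T (j + J)) =
      (∑ j ∈ range J, G j - ∑ j ∈ range J, T j) + ∑ j ∈ Ico J N, G j +
        sameBlockRem P (hsDiameter σ N) (N + 1) h2 (g N x) (g N x) / XiN P σ N (N + 1) - ∑' j, T (j + J) := by
    ring
  rw [hsplit]
  have hx1 := abs_sub (∑ j ∈ range J, G j - ∑ j ∈ range J, T j + ∑ j ∈ Ico J N, G j +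
      sameBlockRem P (hsDiameter σ N) (N + 1) h2 (g N x) (g N x) / XiN P σ N (N + 1)) (∑' j, T (j + J))
  have hx2 := abs_add_le (∑ j ∈ range J, G j - ∑ j ∈ range J, T j + ∑ j ∈ Ico J N, G j)
      (sameBlockRem P (hsDiameter σ N) (N + 1) h2 (g N x) (g N x) / XiN P σ N (N + 1))
  have hx3 := abs_add_le (∑ j ∈ range J, G j - ∑ j ∈ range J, T j) (∑ j ∈ Ico J N, G j)
  linarith

end LGFS
end Summit.AtomisticToContinuum.HydrodynamicLimit.Theorems
end
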